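import Literature.Probability.LatticeModels.InfraredLongRangeOrder
import Literature.Probability.LatticeModels.TorusMomentumLatticeSums
import HarnessLib

/-!
# Finite Fourier inputs of the heavy-twist wall on `(ℤ/L)³`: a uniform bound on the torus Green function and slice sums

HELPER 3/6 for the crux `BalabanLadder.IR` (stmt-QuantumFields-19354), line `heavy-twist` RUNG 2 on even boxes (wall seat
`ym-ir-wall-p1`; D4 «finite Fourier» of the recipe ym-ir-crit-3 2026-08-28T07:11:56Z).  Model-free finite Fourier analysis
on the torus `(ℤ/L)³` (the tree's `torusFourier`, `torusGreen`, `latticeMomentum`, `dispersion`), all PROVED, no definitions: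

* `sum_inv_normSq_box_le` — the lattice shell bound `Σ_{0 ≠ s ∈ [-R,R]³} (s₁² + s₂² + s₃²)⁻¹ ≤ 26 R` (the `ℓ^∞`-shell of
  radius `n + 1` has `(2n+3)³ − (2n+1)³ ≤ 26 (n+1)²` points at Euclidean norm `≥ n + 1`);
* `torusGreen_zero_le` — **`torusGreen 0 ≤ 13/8` on `(ℤ/L)³`, uniformly in `L`** (Jordan: `ε(p_k) ≥ 8 Σ‖kᵢ‖²/L²`,
  `dispersion_latticeMomentum_ge`, then the shell bound with `R = L/2`); this is the finite-volume constant in the sum rule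
  `G(0) − B·torusGreen 0 ≤ L⁻³ Re Ĝ(0)` (`sub_mul_torusGreen_le_zeroMode`);
* `sum_inv_one_sub_cos_le` — `Σ_{0 ≠ a ∈ ℤ/L} (1 − cos(2πa/L))⁻¹ ≤ L³/8` (crude, sufficient).
The slice-sum estimates built on these are in the companion `BalabanLadderIRHeavyTwistWallSliceFourier`.

HONEST FRAMING: lattice Fourier bookkeeping; nothing here proves `BalabanLadder.IR`, its seed, or the Yang–Mills mass gap (Clay).
References: J. Fröhlich, B. Simon, T. Spencer, Commun. Math. Phys. 50 (1976) 79 §3; C. Borgs, E. Seiler, Commun. Math. Phys. 91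
(1983) 329, proof of Cor. III.5; S. Friedli, Y. Velenik (2017) §10.4.
-/

set_option autoImplicit false

noncomputable section

open Finset Real ZMod
open Literature.Probability.LatticeModels

namespace Summit.QuantumFields.YangMills.Cruxes.IR.HeavyTwistWall

/-! ## The three-dimensional shell bound -/

section Shell

/-- **Shell bound in `ℤ³`**: `Σ_{0 ≠ s ∈ [-R,R]³} (s₁² + s₂² + s₃²)⁻¹ ≤ 26 R`. -/
theorem sum_inv_normSq_box_le (R : ℕ) :
    ∑ s ∈ ((Icc (-(R : ℤ)) R) ×ˢ ((Icc (-(R : ℤ)) R) ×ˢ (Icc (-(R : ℤ)) R))).filter (fun s => s ≠ 0),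
      1 / (((s.1 : ℤ) : ℝ) ^ 2 + ((s.2.1 : ℤ) : ℝ) ^ 2 + ((s.2.2 : ℤ) : ℝ) ^ 2) ≤ 26 * (R : ℝ) := by
  classical
  set B : ℕ → Finset (ℤ × ℤ × ℤ) := fun n =>
    (Icc (-(n : ℤ)) n) ×ˢ ((Icc (-(n : ℤ)) n) ×ˢ (Icc (-(n : ℤ)) n)) with hB
  set f : ℤ × ℤ × ℤ → ℝ := fun s => 1 / (((s.1 : ℤ) : ℝ) ^ 2 + ((s.2.1 : ℤ) : ℝ) ^ 2 + ((s.2.2 : ℤ) : ℝ) ^ 2)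
    with hf
  have hf0 : ∀ s, 0 ≤ f s := fun s => by positivity
  have hIcc : ∀ n : ℕ, (Icc (-(n : ℤ)) n).card = 2 * n + 1 := fun n => by
    rw [Int.card_Icc]; omega
  have hcardB : ∀ n : ℕ, (B n).card = (2 * n + 1) ^ 3 := fun n => by
    rw [hB, card_product, card_product, hIcc]; ring
  have hmono : ∀ n : ℕ, B n ⊆ B (n + 1) := fun n => by
    intro s hs
    simp only [hB, mem_product, mem_Icc] at hs ⊢
    push_cast
    omega
  have hzero : ∀ n : ℕ, (0 : ℤ × ℤ × ℤ) ∈ B n := fun n => by simp [hB]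
  -- on the shell `B (n+1) \ B n` every point has `f ≤ 1/(n+1)²`
  have hshell : ∀ n : ℕ, ∀ s ∈ B (n + 1) \ B n, f s ≤ 1 / ((n : ℝ) + 1) ^ 2 := by
    intro n s hs
    rw [mem_sdiff] at hs
    obtain ⟨hs1, hs2⟩ := hs
    simp only [hB, mem_product, mem_Icc, not_and_or, not_le] at hs1 hs2
    have hbig : ((n : ℝ) + 1) ^ 2 ≤ ((s.1 : ℤ) : ℝ) ^ 2 + ((s.2.1 : ℤ) : ℝ) ^ 2 + ((s.2.2 : ℤ) : ℝ) ^ 2 := by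
      have h1 : ((n : ℤ) + 1) ^ 2 ≤ s.1 ^ 2 ∨ ((n : ℤ) + 1) ^ 2 ≤ s.2.1 ^ 2 ∨ ((n : ℤ) + 1) ^ 2 ≤ s.2.2 ^ 2 := by
        push_cast at hs1
        rcases hs2 with (h | h) | ((h | h) | (h | h))
        · left; nlinarith
        · left; nlinarith
        · right; left; nlinarith
        · right; left; nlinarith
        · right; right; nlinarith
        · right; right; nlinarith
      rcases h1 with h | h | h
      · have : (((n : ℤ) + 1) ^ 2 : ℝ) ≤ ((s.1 ^ 2 : ℤ) : ℝ) := by exact_mod_cast h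
        push_cast at this
        nlinarith [sq_nonneg ((s.2.1 : ℤ) : ℝ), sq_nonneg ((s.2.2 : ℤ) : ℝ)]
      · have : (((n : ℤ) + 1) ^ 2 : ℝ) ≤ ((s.2.1 ^ 2 : ℤ) : ℝ) := by exact_mod_cast h
        push_cast at this
        nlinarith [sq_nonneg ((s.1 : ℤ) : ℝ), sq_nonneg ((s.2.2 : ℤ) : ℝ)]
      · have : (((n : ℤ) + 1) ^ 2 : ℝ) ≤ ((s.2.2 ^ 2 : ℤ) : ℝ) := by exact_mod_cast h
        push_cast at this
        nlinarith [sq_nonneg ((s.1 : ℤ) : ℝ), sq_nonneg ((s.2.1 : ℤ) : ℝ)]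
    have hpos : (0 : ℝ) < ((n : ℝ) + 1) ^ 2 := by positivity
    rw [hf]
    exact one_div_le_one_div_of_le hpos hbig
  -- induction on `R`
  suffices H : ∀ n : ℕ, ∑ s ∈ (B n).filter (fun s => s ≠ 0), f s ≤ 26 * (n : ℝ) by
    simpa [hB, hf] using H R
  intro n
  induction n with
  | zero =>
    have : (B 0).filter (fun s => s ≠ 0) = ∅ := by
      ext s
      simp only [hB, mem_filter, mem_product, mem_Icc, notMem_empty, iff_false, not_and, not_not]
      intro h
      push_cast at h
      ext <;> simp <;> omega
    rw [this, sum_empty]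
    simp
  | succ n ih =>
    have hsplit : (B (n + 1)).filter (fun s => s ≠ 0) = (B n).filter (fun s => s ≠ 0) ∪ (B (n + 1) \ B n) := by
      ext s
      simp only [mem_filter, mem_union, mem_sdiff]
      constructor
      · rintro ⟨h1, h2⟩
        by_cases h : s ∈ B n
        · exact Or.inl ⟨h, h2⟩
        · exact Or.inr ⟨h1, h⟩
      · rintro (⟨h1, h2⟩ | ⟨h1, h2⟩)
        · exact ⟨hmono n h1, h2⟩
        · exact ⟨h1, fun h => h2 (h ▸ hzero n)⟩
    have hdisj : Disjoint ((B n).filter (fun s => s ≠ 0)) (B (n + 1) \ B n) := by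
      rw [disjoint_left]
      intro s hs hs'
      exact (mem_sdiff.1 hs').2 (mem_filter.1 hs).1
    rw [hsplit, sum_union hdisj]
    have hcard : ((B (n + 1) \ B n).card : ℝ) = 24 * ((n : ℝ) + 1) ^ 2 + 2 := by
      rw [card_sdiff_of_subset (hmono n), hcardB, hcardB]
      have : (2 * n + 1) ^ 3 ≤ (2 * (n + 1) + 1) ^ 3 := Nat.pow_le_pow_left (by omega) 3
      push_cast [Nat.cast_sub this]
      ring
    have h2 : ∑ s ∈ B (n + 1) \ B n, f s ≤ 26 := by
      have hpos : (0 : ℝ) < ((n : ℝ) + 1) ^ 2 := by positivity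
      calc ∑ s ∈ B (n + 1) \ B n, f s ≤ ∑ _s ∈ B (n + 1) \ B n, 1 / ((n : ℝ) + 1) ^ 2 := sum_le_sum (hshell n)
        _ = ((B (n + 1) \ B n).card : ℝ) * (1 / ((n : ℝ) + 1) ^ 2) := by rw [sum_const, nsmul_eq_mul]
        _ = 24 + 2 / ((n : ℝ) + 1) ^ 2 := by rw [hcard]; field_simp
        _ ≤ 24 + 2 / 1 := by
            gcongr
            have : (1 : ℝ) ≤ (n : ℝ) + 1 := by linarith [Nat.cast_nonneg (α := ℝ) n]
            nlinarith
        _ = 26 := by norm_num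
    push_cast
    linarith

end Shell

/-! ## The torus Green function at the origin is bounded by `13/8` on `(ℤ/L)³` -/

section Green

variable {L : ℕ} [NeZero L]

/-- Momenta of `(ℤ/L)³` inject into `[-R, R]³ \ {0}`, `R = L/2`, through their signed representatives, carrying the summand
`(Σᵢ ‖kᵢ‖²)⁻¹`: for any finite set `S` of nonzero momenta, `Σ_{k ∈ S} (Σᵢ ‖kᵢ‖²)⁻¹ ≤ 26 · (L/2)` (`sum_inv_normSq_box_le`). -/
theorem sum_inv_sum_valMinAbs_sq_le (S : Finset (TorusSite 3 L)) (h0 : ∀ k ∈ S, k ≠ 0) :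
    ∑ k ∈ S, 1 / (∑ i : Fin 3, (((k i).valMinAbs : ℤ) : ℝ) ^ 2) ≤ 26 * ((L / 2 : ℕ) : ℝ) := by
  classical
  set R : ℕ := L / 2 with hR
  set φ : TorusSite 3 L → ℤ × ℤ × ℤ := fun k => ((k 0).valMinAbs, (k 1).valMinAbs, (k 2).valMinAbs) with hφ
  set f : ℤ × ℤ × ℤ → ℝ := fun s => 1 / (((s.1 : ℤ) : ℝ) ^ 2 + ((s.2.1 : ℤ) : ℝ) ^ 2 + ((s.2.2 : ℤ) : ℝ) ^ 2)
    with hf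
  have hinj : Set.InjOn φ S := by
    intro P _ Q _ hPQ
    simp only [hφ, Prod.mk.injEq] at hPQ
    funext i
    fin_cases i
    · exact ZMod.injective_valMinAbs hPQ.1
    · exact ZMod.injective_valMinAbs hPQ.2.1
    · exact ZMod.injective_valMinAbs hPQ.2.2
  have hsum : ∑ k ∈ S, 1 / (∑ i : Fin 3, (((k i).valMinAbs : ℤ) : ℝ) ^ 2) = ∑ s ∈ S.image φ, f s := by
    rw [Finset.sum_image hinj]
    refine Finset.sum_congr rfl fun k _ => ?_
    simp only [hf, hφ, Fin.sum_univ_three]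
  rw [hsum]
  have hsub : S.image φ ⊆ ((Icc (-(R : ℤ)) R) ×ˢ ((Icc (-(R : ℤ)) R) ×ˢ (Icc (-(R : ℤ)) R))).filter (fun s => s ≠ 0) := by
    intro s hs
    rw [Finset.mem_image] at hs
    obtain ⟨k, hk, rfl⟩ := hs
    have hc : ∀ i : Fin 3, -(R : ℤ) ≤ (k i).valMinAbs ∧ (k i).valMinAbs ≤ R := fun i => by
      have h : (k i).valMinAbs.natAbs ≤ R := ZMod.natAbs_valMinAbs_le (k i)
      have : |(k i).valMinAbs| ≤ (R : ℤ) := by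
        rw [← Int.natCast_natAbs]; exact_mod_cast h
      exact abs_le.1 this
    simp only [Finset.mem_filter, Finset.mem_product, Finset.mem_Icc, hφ]
    refine ⟨⟨hc 0, hc 1, hc 2⟩, ?_⟩
    intro hzero
    simp only [Prod.mk_eq_zero, ZMod.valMinAbs_eq_zero] at hzero
    apply h0 k hk
    funext i
    fin_cases i
    · exact hzero.1
    · exact hzero.2.1
    · exact hzero.2.2
  calc ∑ s ∈ S.image φ, f s
      ≤ ∑ s ∈ ((Icc (-(R : ℤ)) R) ×ˢ ((Icc (-(R : ℤ)) R) ×ˢ (Icc (-(R : ℤ)) R))).filter (fun s => s ≠ 0), f s :=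
        Finset.sum_le_sum_of_subset_of_nonneg hsub fun s _ _ => by positivity
    _ ≤ 26 * (R : ℝ) := sum_inv_normSq_box_le R

/-- **`torusGreen 0 ≤ 13/8` on `(ℤ/L)³`, uniformly in `L ≥ 1`.**  `torusGreen 0 = L⁻³ Σ_{k ≠ 0} ε(p_k)⁻¹` with
`ε(p_k) ≥ 8 Σᵢ ‖kᵢ‖²/L²` (Jordan), so `torusGreen 0 ≤ (8L)⁻¹ Σ_{k ≠ 0} (Σᵢ‖kᵢ‖²)⁻¹ ≤ (8L)⁻¹ · 26 · (L/2) ≤ 13/8`. -/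
theorem torusGreen_zero_le : torusGreen (0 : TorusSite 3 L) ≤ 13 / 8 := by
  classical
  have hL : (0 : ℝ) < L := Nat.cast_pos.2 (Nat.pos_of_ne_zero (NeZero.ne L))
  rw [torusGreen_zero]
  -- termwise: `ε(p_k)⁻¹ ≤ (L²/8) (Σᵢ ‖kᵢ‖²)⁻¹`
  have hterm : ∀ k ∈ (univ : Finset (TorusSite 3 L)).erase 0,
      (dispersion (latticeMomentum L k))⁻¹ ≤ (L : ℝ) ^ 2 / 8 * (1 / ∑ i : Fin 3, (((k i).valMinAbs : ℤ) : ℝ) ^ 2) := by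
    intro k hk
    have hk0 : k ≠ 0 := Finset.ne_of_mem_erase hk
    have hv : (1 : ℝ) ≤ ∑ i : Fin 3, (((k i).valMinAbs : ℤ) : ℝ) ^ 2 := one_le_sum_valMinAbs_sq hk0
    have hvpos : (0 : ℝ) < ∑ i : Fin 3, (((k i).valMinAbs : ℤ) : ℝ) ^ 2 := by linarith
    have hd := dispersion_latticeMomentum_ge (d := 3) (M := L) k
    have hlow : (0 : ℝ) < 8 * (∑ i : Fin 3, (((k i).valMinAbs : ℤ) : ℝ) ^ 2) / (L : ℝ) ^ 2 := by positivity
    calc (dispersion (latticeMomentum L k))⁻¹ ≤ (8 * (∑ i : Fin 3, (((k i).valMinAbs : ℤ) : ℝ) ^ 2) / (L : ℝ) ^ 2)⁻¹ :=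
          inv_anti₀ hlow hd
      _ = (L : ℝ) ^ 2 / 8 * (1 / ∑ i : Fin 3, (((k i).valMinAbs : ℤ) : ℝ) ^ 2) := by
          field_simp
  have hsum : ∑ k ∈ (univ : Finset (TorusSite 3 L)).erase 0, (dispersion (latticeMomentum L k))⁻¹ ≤
      (L : ℝ) ^ 2 / 8 * (26 * ((L / 2 : ℕ) : ℝ)) := by
    calc ∑ k ∈ (univ : Finset (TorusSite 3 L)).erase 0, (dispersion (latticeMomentum L k))⁻¹
        ≤ ∑ k ∈ (univ : Finset (TorusSite 3 L)).erase 0,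
            (L : ℝ) ^ 2 / 8 * (1 / ∑ i : Fin 3, (((k i).valMinAbs : ℤ) : ℝ) ^ 2) := Finset.sum_le_sum hterm
      _ = (L : ℝ) ^ 2 / 8 * ∑ k ∈ (univ : Finset (TorusSite 3 L)).erase 0,
            (1 / ∑ i : Fin 3, (((k i).valMinAbs : ℤ) : ℝ) ^ 2) := by rw [Finset.mul_sum]
      _ ≤ (L : ℝ) ^ 2 / 8 * (26 * ((L / 2 : ℕ) : ℝ)) :=
          mul_le_mul_of_nonneg_left (sum_inv_sum_valMinAbs_sq_le _ fun k hk => Finset.ne_of_mem_erase hk)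
            (by positivity)
  have hhalf : ((L / 2 : ℕ) : ℝ) ≤ (L : ℝ) / 2 := by
    have h := Nat.div_mul_le_self L 2
    have : ((L / 2 : ℕ) : ℝ) * 2 ≤ (L : ℝ) := by exact_mod_cast h
    linarith
  rw [div_le_iff₀ (by positivity)]
  calc ∑ k ∈ (univ : Finset (TorusSite 3 L)).erase 0, (dispersion (latticeMomentum L k))⁻¹
      ≤ (L : ℝ) ^ 2 / 8 * (26 * ((L / 2 : ℕ) : ℝ)) := hsum
    _ ≤ (L : ℝ) ^ 2 / 8 * (26 * ((L : ℝ) / 2)) := by gcongr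
    _ = 13 / 8 * (L : ℝ) ^ 3 := by ring

/-! ## The one-dimensional sum `Σ_{a ≠ 0} (1 − cos(2πa/L))⁻¹ ≤ L³/8` -/

/-- **`Σ_{0 ≠ a ∈ ℤ/L} (1 − cos(2πa/L))⁻¹ ≤ L³/8`** (Jordan: `1 − cos(2πa/L) ≥ 8‖a‖²/L² ≥ 8/L²` for `a ≠ 0`, and there are
at most `L` terms; crude but sufficient for the wall's constants). -/
theorem sum_inv_one_sub_cos_le :
    ∑ a ∈ (univ : Finset (ZMod L)).erase 0, 1 / (1 - Real.cos (2 * Real.pi * (a.val : ℝ) / L)) ≤ (L : ℝ) ^ 3 / 8 := by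
  classical
  have hL : (0 : ℝ) < L := Nat.cast_pos.2 (Nat.pos_of_ne_zero (NeZero.ne L))
  have hterm : ∀ a ∈ (univ : Finset (ZMod L)).erase 0,
      1 / (1 - Real.cos (2 * Real.pi * (a.val : ℝ) / L)) ≤ (L : ℝ) ^ 2 / 8 := by
    intro a ha
    have ha0 : a ≠ 0 := Finset.ne_of_mem_erase ha
    -- the one-dimensional momentum `(a)` of `(ℤ/L)¹`
    have hd := dispersion_latticeMomentum_ge (d := 1) (M := L) (fun _ => a)
    simp only [dispersion, latticeMomentum, Finset.univ_unique, Finset.sum_singleton] at hd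
    have hv : (1 : ℝ) ≤ (((a.valMinAbs : ℤ) : ℝ) ^ 2) := by
      have h := one_le_sum_valMinAbs_sq (d := 1) (M := L) (p := fun _ => a) (fun h => ha0 (congrFun h 0))
      simpa using h
    have hlow : (0 : ℝ) < 8 / (L : ℝ) ^ 2 := by positivity
    have h8 : 8 / (L : ℝ) ^ 2 ≤ 1 - Real.cos (2 * Real.pi * (a.val : ℝ) / L) := by
      refine le_trans ?_ hd
      rw [div_le_div_iff_of_pos_right (by positivity)]
      linarith
    calc 1 / (1 - Real.cos (2 * Real.pi * (a.val : ℝ) / L)) ≤ 1 / (8 / (L : ℝ) ^ 2) :=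
          one_div_le_one_div_of_le hlow h8
      _ = (L : ℝ) ^ 2 / 8 := by field_simp
  calc ∑ a ∈ (univ : Finset (ZMod L)).erase 0, 1 / (1 - Real.cos (2 * Real.pi * (a.val : ℝ) / L))
      ≤ ∑ _a ∈ (univ : Finset (ZMod L)).erase 0, (L : ℝ) ^ 2 / 8 := Finset.sum_le_sum hterm
    _ = (((univ : Finset (ZMod L)).erase 0).card : ℝ) * ((L : ℝ) ^ 2 / 8) := by rw [Finset.sum_const, nsmul_eq_mul]
    _ ≤ (L : ℝ) * ((L : ℝ) ^ 2 / 8) := by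
        gcongr
        have h : ((univ : Finset (ZMod L)).erase 0).card ≤ (univ : Finset (ZMod L)).card := Finset.card_erase_le
        rw [Finset.card_univ, ZMod.card] at h
        exact_mod_cast h
    _ = (L : ℝ) ^ 3 / 8 := by ring

end Green

end Summit.QuantumFields.YangMills.Cruxes.IR.HeavyTwistWall

end
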